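import Literature.MathematicalPhysics.QuantumFieldTheory.Balaban1983to89.B6HolderGrad2PairInputsV1
import Literature.MathematicalPhysics.QuantumFieldTheory.Balaban1983to89.B6HolderGrad2GEPairInputsV1
import Literature.MathematicalPhysics.QuantumFieldTheory.Balaban1983to89.B6Grad2NormSuppLegKLevelV1
import Literature.MathematicalPhysics.QuantumFieldTheory.Balaban1983to89.B6HolderLegPairTermsV1
import Literature.MathematicalPhysics.QuantumFieldTheory.Balaban1983to89.B6HolderPairGeometryV1

/-!
# `Balaban1983to89.B6HolderGrad2NormSuppLegKLevelV1` — T. Bałaban, *Propagators and renormalization transformations for lattice gauge theories. II*,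
Comm. Math. Phys. **96** (1984) 223–250 [Balaban1984PropagatorsII], Prop. 2.6 (2.139) p. 247 with (2.141) p. 247: **THE `n = 0` LEG
`P_{x,x′}·∇_ν(h_□G_□h_□)∇_μ*` OF THE RANDOM WALK ON THE CENSUS HÖLDER CLASS, PER CUBE, FOR AN ADMISSIBLE GLOBAL PAIR** — the Hölder-OUTPUT twin of
p27's `…B6Grad2NormSuppLegKLevelV1.hD2hGh0_cube`: the hypothesis (hlegs0) of this seat's `…B6Prop26HolderGrad2KLevelV1.holderGrad2_pair_kLevel_census`,
now a theorem.

HONEST FRAMING (programme rule): statement-level skeleton of published theorems with citation tags; proofs where landed; nothing here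
is a claim about the Yang–Mills mass gap.

PRINT: (2.139) p. 247 «‖ζ∇G∇*J‖_α ≤ O(1)(L^jη)^{−α}(‖ζ‖^ξ_α + |ζ|)e^{−δ₃d(y,y′)}(‖J‖^{ξ′}_{α+ε} + |J|)»; (2.141) p. 247 (the random walk; n = 0 term
`h_{□₀}G_{□₀}h_{□₀}`); [4] (1.109) p. 35 (the Hölder quotient), (1.113) p. 36.

THE MATHEMATICS.  `∇_ν(h_□G_□h_□)∇_μ* = s²(S_νh)E⁺G_□E⁻(S_μh) + s(S_νh)E⁺G_□(∇_μh) + s(∇_νh)G_□E⁻(S_μh) + (∇_νh)G_□(∇_μh)` (`s = c′/L^{j₀}`,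
`…grad2_sandwich_eq`), and for each term `P_{x,x′}·(f·)·T = f(x′)·P_{x,x′}T + (f(x) − f(x′))·1_x T` (`hasMajorantA_pair_mulOp`): the PAIR letters are
`…hHEGE_pair_cube` ([4] (1.113)), p22's `…pairInputs_cube` (`E⁺G_□`, `G_□`) and `…pairInputsGE_cube` (`G_□E⁻`); the single-point letters are p27's
`hEGE_cube` and p22's `hEGin_cube`, `hGEin_cube`, `hGin_cube`; the sizes of `S_νh`, `∇_νh` and of their displacements are p38's
(`abs_hB_sub_le_supDist`, `abs_DV_hB_sub_le_supDist`); if `h_□` vanishes at `x, x + e_ν, x′, x′ + e_ν` the entry is `0`, otherwise p22's `pair_levels` /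
`pair_distT_le` place both blocks at levels `j₀, j₀ + 1` within `d_T ≤ (d+1)(L+1)`, which turns every prefactor into `O(1)·t^α`, `t = |x − x′|_∞/L^{j(y(x))}`.

## WHAT THIS FILE CERTIFIES (kernel-checked, sorry-free, standard axioms; THEOREMS ONLY)

* §1 two scalar tools; the operator tools (`hasMajorantA_pair_mulOp` = the product rule at two points on an admissible-input class,
  `hasMajorant_mul_mulOp_bdd`, `outLoc_pairOp_mul`) are in `…B6HolderGrad2PairInputsV1`;
* §2 **`holderGrad2Leg0_pair_cube`** — ONE `ρ₀ > 0` and, for `0 ≤ α`, `0 < ε`, `α + ε < 1`, ONE `C ≥ 0` with: on every admissible V1 torus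
  (`M_h = Lᵃ ≥ 8`, `R ≥ 2L²`, `P′ ≥ 5`, `L ≥ 5`, cube placed), for every `c′ ≠ 0`, weights, directions `ν, μ`, cube `□` and admissible pair `(x, x′)`:
  `HasMajorantA (NormSupp {y′} (‖·‖_{α+ε} + |·|)) (P_{x,x′}·∇_ν(h_□G_□h_□)∇_μ*) (1_{Q^T_□}(y′)·C·t^α·e^{−ρ₀d_T})` — VERBATIM the hypothesis (hlegs0) of
  `holderGrad2_pair_kLevel_census` (there with the band `a₀ = b₀/L`, `a₁ = b₁L^d`).

HONEST SCOPE: one cube; census sub-case `supp J ⊂ Δ(y′)` (GAPS G-B6-2138-SUPP); constants ours.  NOT summit progress.  Unit `pub-ymgap-dag-n02-b`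
(Track-A seat, D-0062; slot c4 of node N03), 2026-08-26.
-/

noncomputable section

open scoped BigOperators
open Finset

namespace Literature.MathematicalPhysics.QuantumFieldTheory.Balaban1983to89.B6HolderGrad2NormSuppLegKLevelV1

open LatticeFieldCalculus
open B6MultiLevelBoxOperator (N0 bigSide)
open B6Cover236MultiLevelBlocks (cubes)
open B6Geom246MultiLevelBox (bset)
open B6Geom246MultiLevelTorus (geomT)
open B6MultiLevelTorusOperator (TDomains)
open B8Ineq192MultiLevelTorus (geomT_len)
open B6Eq238MultiLevelTorus (svec)
open B6RandomWalk (HasMajorant BlockSupp)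
open B6Prop26Gluing (mulOp mulOp_apply ind ind_nonneg ind_of_mem ind_of_not_mem OutLoc)
open B6GlobalChartV1 (PV toBox blkV1 domT)
open B6SectAOperatorsV1 (BondIdx)
open B6Partition118KLevelFineSizes (C1F C1F_nonneg)
open B6Partition118KLevelFineMixed (C2X C2X_bounds)
open B6Partition118KLevelTorusCentral (one_le_of_four_le)
open B6Prop26KLevelSkeletonV1 (hB ST mem_ST pref pref_nonneg abs_hB_le_one blkV1_mem_QT_of_hB_ne_zero)
open B6InMajorantTransplant (InMajorant)
open B6CubeWindowV1 (Placed j0 sc sc_ne_zero Gl one_le_bigSide_real)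
open B6Eq292MemberTorusV1 (EC)
open B6CubeInDecayV1 (hGin_cube hEGin_cube sc_nonneg)
open B6CubeRightLegsV1 (hGEin_cube)
open B6GradLegKLevelV1 (shB shB_apply DV DV_apply blkV1_mem_ST_of_hB_shift_ne_zero)
open B6LapLegKLevelV1 (DVa)
open B6RandomWalkInputNorm (HasMajorantA NormSupp hasMajorantA_smul hasMajorantA_mono hasMajorantA_add)
open B6RandomWalkInputNormChain (hasMajorantA_localise_out mulOp_eq_zero_of_region)
open B6HolderNormV1 (supNormV1 holderV1 abs_le_supNormV1 holderV1_nonneg normSupp_mulOp)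
open B6NormSuppDecayWindowV1 (hasMajorantA_mul_right_ind)
open B6CubeNormSuppInDecayV1 (hEGE_cube)
open B6Grad2LegLettersKLevelV1 (hasMajorantA_normSupp_of_sup lip_shB_hB supp_shB_hB supp_DV_hB abs_DV_hB_le grad2_sandwich_eq supDist_shift)
open B6HBDisplacementLipV1 (abs_hB_sub_le_supDist abs_DV_hB_sub_le_supDist)
open B6HolderLegPairTermsV1 (pow_j0_le_S)
open B6HolderPairMemberV1 (pairOp pairOp_apply pairOp_mul_apply)
open B6HolderPairInputsV1 (pairInputs_cube level_le_j0_succ_of_mem_ST)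
open B6HolderPairGeometryV1 (pair_levels pair_distT_le)
open B6HolderGrad2PairInputsV1 (hHEGE_pair_cube hasMajorant_mul_mulOp_bdd hasMajorantA_pair_mulOp outLoc_pairOp_mul)
open B6HolderGrad2GEPairInputsV1 (pairInputsGE_cube)

/-! ## §1  Tools -/

section Tools

/-- two kernel terms under one rate: `c·(s·(i·(A·e₁)) + σ·(i·(B·e₂))) ≤ i·((c·(s·A + σ·B))·e₀)` for `e₁, e₂ ≤ e₀` and non-negative data. [folklore] -/
private theorem two_terms_le {i c s σ A B e₁ e₂ e₀ : ℝ} (hi : 0 ≤ i) (hc : 0 ≤ c) (hs : 0 ≤ s) (hσ : 0 ≤ σ) (hA : 0 ≤ A) (hB : 0 ≤ B)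
    (h1 : e₁ ≤ e₀) (h2 : e₂ ≤ e₀) :
    c * (s * (i * (A * e₁)) + σ * (i * (B * e₂))) ≤ i * ((c * (s * A + σ * B)) * e₀) := by
  have t1 := mul_le_mul_of_nonneg_left h1 (by positivity : 0 ≤ c * s * i * A)
  have t2 := mul_le_mul_of_nonneg_left h2 (by positivity : 0 ≤ c * σ * i * B)
  calc c * (s * (i * (A * e₁)) + σ * (i * (B * e₂))) = c * s * i * A * e₁ + c * σ * i * B * e₂ := by ring
    _ ≤ c * s * i * A * e₀ + c * σ * i * B * e₀ := add_le_add t1 t2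
    _ = i * ((c * (s * A + σ * B)) * e₀) := by ring

/-- `t ≤ t^α` on `[0, 1]` for `α ≤ 1`. [folklore] -/
private theorem le_rpow_self {t α : ℝ} (ht0 : 0 ≤ t) (ht1 : t ≤ 1) (hα1 : α ≤ 1) : t ≤ t ^ α := by
  rcases eq_or_lt_of_le ht0 with h | h
  · rw [← h]; exact Real.rpow_nonneg le_rfl _
  · calc t = t ^ (1 : ℝ) := (Real.rpow_one t).symm
      _ ≤ t ^ α := Real.rpow_le_rpow_of_exponent_ge h ht1 hα1

end Tools

/-! ## §2  The `n = 0` leg of (2.139) on the Hölder class, per cube, admissible pairs -/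

section Leg

variable {d ℓ : ℕ} {hd : 1 ≤ d + 1} {hL : Odd (ℓ + 1) ∧ 1 < ℓ + 1} {m K : ℕ} {Mh k R : ℕ} {P' : Fin (d + 1) → ℕ}

/-- rate monotonicity of the exponential kernel. [folklore] -/
private theorem exp_le_exp_of_rate {ρ ρ' t : ℝ} (h : ρ' ≤ ρ) (ht : 0 ≤ t) : Real.exp (-(ρ * t)) ≤ Real.exp (-(ρ' * t)) :=
  Real.exp_le_exp.mpr (neg_le_neg (mul_le_mul_of_nonneg_right h ht))

set_option maxHeartbeats 800000 in
open Classical in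
/-- **THE `n = 0` LEG `P_{x,x′}·∇_ν(h_□G_□h_□)∇_μ*` OF (2.141) ON THE CENSUS HÖLDER CLASS, PER CUBE, ADMISSIBLE GLOBAL PAIRS** (`L ≥ 5`): there is
`ρ₀ > 0` (on `d, L, a₀, a₁`) and, for `0 ≤ α`, `0 < ε`, `α + ε < 1`, a constant `C ≥ 0` such that on every admissible V1 torus (`M_h = Lᵃ ≥ 8`, `R ≥ 2L²`,
`P′ ≥ 5`, cube placed), for every `c′ ≠ 0`, weights, directions `ν, μ`, cube `□` and fine bonds `x, x′` of the same direction with `|x − x′|_∞ ≤ L^{j(y(x))}`,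
`|x − x′|_∞ ≤ L^{j(y(x′))}`:
`HasMajorantA (NormSupp {y′} (‖·‖_{α+ε} + |·|)) (P_{x,x′}·∇_ν(h_□G_□h_□)∇_μ*) (1_{Q^T_□}(y′)·C·t^α·e^{−ρ₀ d_T(y,y′)})`, `t = |x − x′|_∞/L^{j(y(x))}` —
pointwise: `|(∇_ν(h_□G_□h_□)∇_μ*J)(x) − (∇_ν(h_□G_□h_□)∇_μ*J)(x′)| ≤ C t^α e^{−ρ₀d_T(y(x),y′)}(‖J‖_{α+ε} + |J|)` for `J` supported in the block `y′ ∈ Q^T_□`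
(and `0` for `y′ ∉ Q^T_□`): print's `O(1)(L^jη)^{−α}|x − x′|^α e^{−δ₃d}(‖J‖_{α+ε} + |J|)` for the `n = 0` term, lengths cancelled.
[cite: Balaban1984PropagatorsII, Prop. 2.6 (2.139) p.247, (2.141) p.247, (2.133) p.247, (2.92)–(2.94) p.239; Balaban1984PropagatorsI, (1.109) p.35, (1.113) p.36] -/
theorem holderGrad2Leg0_pair_cube (d ℓ : ℕ) (hd : 1 ≤ d + 1) (hL : Odd (ℓ + 1) ∧ 1 < ℓ + 1) {a₀ a₁ : ℝ} (ha₀ : 0 < a₀) (ha₁ : a₀ ≤ a₁) :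
    ∃ ρ₀ : ℝ, 0 < ρ₀ ∧ ∀ (α ε : ℝ), 0 ≤ α → 0 < ε → α + ε < 1 → ∃ C : ℝ, 0 ≤ C ∧
      ∀ (m K : ℕ) {Mh k R : ℕ} {P' : Fin (d + 1) → ℕ}
        (hN : ∀ μ, N0 ℓ Mh k P' μ = (PV d ℓ m K hd hL).sitesPerDir 0) (D : TDomains d ℓ Mh k P' R) (hk : k ≤ m + K)
        (hMh1 : 1 ≤ Mh) (hP4 : ∀ μ, 4 ≤ P' μ) {a : ℕ} (hMha : Mh = (ℓ + 1) ^ a) (_ : 8 ≤ Mh) (_ : 2 * (ℓ + 1) ^ 2 ≤ R) (_ : ∀ μ, 5 ≤ P' μ)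
        (_ : 4 ≤ ℓ) (c : ↥(cubes D.toDomains)) (hpl : Placed ℓ k P' c.1) (w : BondIdx (domT hN D hk) → ℝ) {cf : ℝ} (_ : cf ≠ 0)
        (ν μ : Fin (d + 1)) (x x' : PBond (PV d ℓ m K hd hL) 0), x.dir = x'.dir →
        supDist x.src x'.src ≤ (ℓ + 1) ^ (blkV1 hN D x).1.1 → supDist x.src x'.src ≤ (ℓ + 1) ^ (blkV1 hN D x').1.1 →
        HasMajorantA (g := geomT D) (blkV1 hN D)
          (NormSupp (g := geomT D) (blkV1 hN D) (fun y' => ({y'} : Set (geomT D).Site)) (fun _ J => holderV1 hN D (α + ε) J + supNormV1 J))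
          (pairOp x x' * (DV (P := PV d ℓ m K hd hL) ν cf *
            (mulOp (hB hN D c) * Gl hN hk hMh1 hP4 hMha c ha₁ hpl w cf * mulOp (hB hN D c)) *
            DVa (P := PV d ℓ m K hd hL) μ cf))
          (fun y y' => ind (ST D hMh1 hP4 c) y' * (C * ((((supDist x.src x'.src : ℕ) : ℝ) / (((ℓ + 1 : ℕ) : ℝ)) ^ (blkV1 hN D x).1.1) ^ α) *
            Real.exp (-(ρ₀ * (geomT D).dist y y')))) := by
  -- the letters and their constants
  obtain ⟨ρP, hρP, ρ1P, hρ1P, HP⟩ := hHEGE_pair_cube d ℓ hd hL ha₀ ha₁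
  obtain ⟨ρB, hρB, ρ1B, hρ1B, HB⟩ := pairInputs_cube d ℓ hd hL ha₀ ha₁
  obtain ⟨ρC, hρC, ρ1C, hρ1C, HC⟩ := pairInputsGE_cube d ℓ hd hL ha₀ ha₁
  obtain ⟨ρA, hρA, HA⟩ := hEGE_cube d ℓ hd hL ha₀ ha₁
  obtain ⟨ρE, hρE, CE, hCE, hEGin⟩ := hEGin_cube d ℓ hd hL ha₀ ha₁
  obtain ⟨ρF, hρF, CF, hCF, hGEin⟩ := hGEin_cube d ℓ hd hL ha₀ ha₁
  obtain ⟨ρG, hρG, CG, hCG, hGin⟩ := hGin_cube d ℓ hd hL ha₀ ha₁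
  have hC1 := C1F_nonneg d ℓ
  have hC2 : 0 ≤ C2X d ℓ := (C2X_bounds d ℓ).2.2
  set ρ₀ : ℝ := min (min (min ρP ρB) (min ρC ρA)) (min (min ρE ρF) ρG) with hρ₀def
  have hρ₀ : 0 < ρ₀ := lt_min (lt_min (lt_min hρP hρB) (lt_min hρC hρA)) (lt_min (lt_min hρE hρF) hρG)
  have rP : ρ₀ ≤ ρP := (min_le_left _ _).trans ((min_le_left _ _).trans (min_le_left _ _))
  have rB : ρ₀ ≤ ρB := (min_le_left _ _).trans ((min_le_left _ _).trans (min_le_right _ _))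
  have rC : ρ₀ ≤ ρC := (min_le_left _ _).trans ((min_le_right _ _).trans (min_le_left _ _))
  have rA : ρ₀ ≤ ρA := (min_le_left _ _).trans ((min_le_right _ _).trans (min_le_right _ _))
  have rE : ρ₀ ≤ ρE := (min_le_right _ _).trans ((min_le_left _ _).trans (min_le_left _ _))
  have rF : ρ₀ ≤ ρF := (min_le_right _ _).trans ((min_le_left _ _).trans (min_le_right _ _))
  have rG : ρ₀ ≤ ρG := (min_le_right _ _).trans (min_le_right _ _)
  refine ⟨ρ₀, hρ₀, fun α ε hα0 hε0 hαε => ?_⟩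
  have hα1 : α < 1 := by linarith
  have hαε0 : 0 < α + ε := by linarith
  obtain ⟨CPA, hCPA, hPA⟩ := HP α ε hα0 hε0 hαε
  obtain ⟨CPB, hCPB, hPB⟩ := HB α hα0 hα1
  obtain ⟨CPC, hCPC, hPC⟩ := HC α hα0 hα1
  obtain ⟨CA, hCA, hA⟩ := HA (α + ε) hαε0 hαε
  -- the fixed geometry numbers
  set L1 : ℝ := ((ℓ + 1 : ℕ) : ℝ) with hL1
  have hL11 : (1 : ℝ) ≤ L1 := by rw [hL1]; exact_mod_cast Nat.succ_pos ℓ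
  have hL10 : (0 : ℝ) < L1 := by positivity
  set Λh : ℝ := ((d : ℝ) + 1) * C1F d ℓ with hΛh
  have hΛh0 : 0 ≤ Λh := by positivity
  set r₀ : ℝ := ((d : ℝ) + 1) * (((ℓ : ℝ) + 1) + 1) with hr₀
  have hr₀0 : 0 ≤ r₀ := by positivity
  set EP : ℝ := Real.exp (ρ1P * r₀) with hEP
  set EB : ℝ := Real.exp (ρ1B * r₀) with hEB
  set EC' : ℝ := Real.exp (ρ1C * r₀) with hEC'
  -- the constant
  set Cbig : ℝ := (1 + Λh) * (CPA * EP * L1 ^ 2 + ((d : ℝ) + 1) * C1F d ℓ * L1 * CA) +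
      C1F d ℓ * L1 ^ 2 * (CPB * EB * L1 ^ 2 + ((d : ℝ) + 1) * C1F d ℓ * L1 * CE) +
      (C1F d ℓ * L1 ^ 2 * (CPC * EC' * L1 ^ 2) + ((d : ℝ) + 1) * C2X d ℓ * L1 ^ 3 * CF) +
      (C1F d ℓ ^ 2 * L1 ^ 2 * (CPB * EB * L1 ^ 2) + ((d : ℝ) + 1) * C2X d ℓ * C1F d ℓ * L1 ^ 3 * CG) with hCbig
  have hCbig0 : 0 ≤ Cbig := by rw [hCbig]; positivity
  refine ⟨Cbig, hCbig0, ?_⟩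
  intro m K Mh k R P' hN D hk hMh1 hP4 a hMha hM8 hR2 hP5 hℓ c hpl w cf hcf ν μ x x' hdir hs1 hs2
  have hMh : 2 ≤ Mh := le_trans (by norm_num) hM8
  have hR : 2 * (ℓ + 1) ≤ R := le_trans (by nlinarith : 2 * (ℓ + 1) ≤ 2 * (ℓ + 1) ^ 2) hR2
  have hP : ∀ μ, 1 ≤ P' μ := one_le_of_four_le hP4
  have hdnn : ∀ y y' : (geomT D).Site, 0 ≤ (geomT D).dist y y' := fun _ _ => Nat.cast_nonneg _
  set S := ST D hMh1 hP4 c with hS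
  set h := hB hN D c with hh
  -- names for the scalar data
  set sR : ℝ := ((supDist x.src x'.src : ℕ) : ℝ) with hsR
  have hsR0 : 0 ≤ sR := Nat.cast_nonneg _
  set jx : ℕ := (blkV1 hN D x).1.1 with hjx
  set Pw : ℝ := L1 ^ jx with hPw
  have hPw0 : 0 < Pw := by positivity
  set t : ℝ := sR / Pw with ht
  have ht0 : 0 ≤ t := by positivity
  have ht1 : t ≤ 1 := by rw [ht, div_le_one hPw0, hsR, hPw, hL1]; exact_mod_cast hs1
  set tα : ℝ := t ^ α with htα
  have htα0 : 0 ≤ tα := Real.rpow_nonneg ht0 _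
  have httα : t ≤ tα := le_rpow_self ht0 ht1 hα1.le
  set J : ℝ := L1 ^ j0 hMh1 hP4 c with hJ
  have hJ0 : 0 < J := by positivity
  set Sf : ℝ := 8 / 5 * (bigSide ℓ Mh c.1.1 : ℝ) with hSf
  have hSf0 : 0 < Sf := by have := one_le_bigSide_real (ℓ := ℓ) hMh1 c.1.1; rw [hSf]; positivity
  have hJS : J ≤ Sf := by rw [hJ, hSf, hL1]; exact pow_j0_le_S hL hMh1 hP4 c hR2
  set tD : ℝ := |cf| * (C1F d ℓ / Sf) with htD
  have htD0 : 0 ≤ tD := by positivity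
  set σS : ℝ := ((d : ℝ) + 1) * sR * (C1F d ℓ / Sf) with hσS
  have hσS0 : 0 ≤ σS := by positivity
  set σD : ℝ := |cf| * (((d : ℝ) + 1) * sR * (C2X d ℓ / Sf ^ 2)) with hσD
  have hσD0 : 0 ≤ σD := by positivity
  have hsc0 : 0 ≤ (sc hMh1 hP4 c cf)⁻¹ := inv_nonneg.2 (sc_nonneg hMh1 hP4 c cf)
  have hscne := sc_ne_zero hMh1 hP4 c hcf
  set τPA : ℝ := CPA * Real.exp (ρ1P * r₀) * (L1 ^ 2 * tα) with hτPA
  set τB : ℝ := CPB * Real.exp (ρ1B * r₀) * (L1 ^ 2 * tα) with hτB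
  set τC : ℝ := CPC * Real.exp (ρ1C * r₀) * (L1 ^ 2 * tα) with hτC
  have hτPA0 : 0 ≤ τPA := by positivity
  have hτB0 : 0 ≤ τB := by positivity
  have hτC0 : 0 ≤ τC := by positivity
  -- supports and sizes of the cut-offs
  have hSν_le : ∀ b, |shB (P := PV d ℓ m K hd hL) ν h b| ≤ 1 := fun b => by rw [shB_apply]; exact abs_hB_le_one hN D hMh1 hP c _
  have hSμ_le : ∀ b, |shB (P := PV d ℓ m K hd hL) μ h b| ≤ 1 := fun b => by rw [shB_apply]; exact abs_hB_le_one hN D hMh1 hP c _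
  have hSμ_supp := supp_shB_hB hN hMh1 hP4 c hM8 hR hP5 μ
  have hDμ_supp := supp_DV_hB hN hMh1 hP4 c hMh hM8 hR hP5 cf μ
  have hDμ_le : ∀ b, |DV (P := PV d ℓ m K hd hL) μ cf h b| ≤ tD := abs_DV_hB_le hN c hMh hR hP5 cf μ
  have hDν_le : ∀ b, |DV (P := PV d ℓ m K hd hL) ν cf h b| ≤ tD := abs_DV_hB_le hN c hMh hR hP5 cf ν
  have hLipS : |shB (P := PV d ℓ m K hd hL) ν h x - shB (P := PV d ℓ m K hd hL) ν h x'| ≤ σS := by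
    rw [shB_apply, shB_apply]
    have h1 := abs_hB_sub_le_supDist hN D c hMh hR hP5 (x := ⟨x.src.shift ν, x.dir⟩) (x' := ⟨x'.src.shift ν, x'.dir⟩) hdir
    rw [supDist_shift] at h1
    simpa only [hσS, hsR, hSf, hh] using h1
  have hLipD : |DV (P := PV d ℓ m K hd hL) ν cf h x - DV (P := PV d ℓ m K hd hL) ν cf h x'| ≤ σD := by
    simpa only [hσD, hsR, hSf, hh] using abs_DV_hB_sub_le_supDist hN D c hMh hR hP5 ν cf hdir
  have hsupN : ∀ (y' : (geomT D).Site) (J : PBond (PV d ℓ m K hd hL) 0 → ℝ) (b : PBond (PV d ℓ m K hd hL) 0),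
      |J b| ≤ holderV1 hN D (α + ε) J + supNormV1 J :=
    fun y' J b => (abs_le_supNormV1 J b).trans (le_add_of_nonneg_left (holderV1_nonneg hN D (α + ε) J))
  have hadm : ∀ (J : PBond (PV d ℓ m K hd hL) 0 → ℝ) (y' : (geomT D).Site) (B : ℝ),
      NormSupp (g := geomT D) (blkV1 hN D) (fun y' => ({y'} : Set (geomT D).Site)) (fun _ J => holderV1 hN D (α + ε) J + supNormV1 J) J y' B →
      0 ≤ B := fun _ _ _ hμ => hμ.nonneg
  -- the class map and the kill of the right cut-off `S_μh` (p27's pattern)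
  have hclsμ : ∀ (J : PBond (PV d ℓ m K hd hL) 0 → ℝ) (y' : (geomT D).Site) (B : ℝ),
      NormSupp (g := geomT D) (blkV1 hN D) (fun y' => ({y'} : Set (geomT D).Site)) (fun _ J => holderV1 hN D (α + ε) J + supNormV1 J) J y' B →
      y' ∈ S → NormSupp (g := geomT D) (blkV1 hN D) (fun y' => ({y'} : Set (geomT D).Site))
        (fun _ J => holderV1 hN D (α + ε) J + supNormV1 J) (mulOp (shB (P := PV d ℓ m K hd hL) μ h) J) y' ((1 + Λh) * B) :=
    fun J y' B hJ _ => normSupp_mulOp hαε.le hΛh0 hSμ_le (fun b b' hq => lip_shB_hB hN hk hMh1 hP4 hMha c hM8 hR2 hP5 hpl μ hq) hJ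
  have hkillμ : ∀ (J : PBond (PV d ℓ m K hd hL) 0 → ℝ) (y' : (geomT D).Site) (B : ℝ),
      NormSupp (g := geomT D) (blkV1 hN D) (fun y' => ({y'} : Set (geomT D).Site)) (fun _ J => holderV1 hN D (α + ε) J + supNormV1 J) J y' B →
      y' ∉ S → mulOp (shB (P := PV d ℓ m K hd hL) μ h) J = 0 :=
    fun J y' B hJ hy => mulOp_eq_zero_of_region (g := geomT D) (blkV1 hN D) (R := fun y' => ({y'} : Set (geomT D).Site))
      (fun b hb => by
        by_contra hne
        exact hb (hJ.off b hne))
      (fun b hb y'' hmem => by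
        rw [Set.mem_singleton_iff] at hmem
        rw [← hmem]
        exact hSμ_supp b hb) hy
  -- non-negativity of the kernel shapes
  have nnA : ∀ (Xc ρ : ℝ), 0 ≤ Xc → ∀ a b : (geomT D).Site,
      0 ≤ ind S b * ((1 + Λh) * ((sc hMh1 hP4 c cf)⁻¹ * (Xc * Real.exp (-(ρ * (geomT D).dist a b))))) := by
    intro Xc ρ hX a b
    exact mul_nonneg (ind_nonneg _ _) (mul_nonneg (by positivity) (mul_nonneg hsc0 (mul_nonneg hX (Real.exp_nonneg _))))
  have nnP : ∀ (Xc ρ u : ℝ), 0 ≤ Xc → 0 ≤ u → ∀ a b : (geomT D).Site,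
      0 ≤ ind S b * (u * (Xc * pref cf a * Real.exp (-(ρ * (geomT D).dist a b)))) := by
    intro Xc ρ u hX hu a b
    have := pref_nonneg cf a; have := ind_nonneg S b; positivity
  -- rates
  have eρ_le : ∀ {ρ : ℝ}, ρ₀ ≤ ρ → ∀ a b : (geomT D).Site,
      Real.exp (-(ρ * (geomT D).dist a b)) ≤ Real.exp (-(ρ₀ * (geomT D).dist a b)) := fun hρ a b => exp_le_exp_of_rate hρ (hdnn a b)
  -- ### the inactive case: the entry vanishes
  by_cases hact : h x ≠ 0 ∨ h ⟨x.src.shift ν, x.dir⟩ ≠ 0 ∨ h x' ≠ 0 ∨ h ⟨x'.src.shift ν, x'.dir⟩ ≠ 0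
  swap
  · have hx0 : h x = 0 := by by_contra hne; exact hact (Or.inl hne)
    have hx1 : h ⟨x.src.shift ν, x.dir⟩ = 0 := by by_contra hne; exact hact (Or.inr (Or.inl hne))
    have hx'0 : h x' = 0 := by by_contra hne; exact hact (Or.inr (Or.inr (Or.inl hne)))
    have hx'1 : h ⟨x'.src.shift ν, x'.dir⟩ = 0 := by by_contra hne; exact hact (Or.inr (Or.inr (Or.inr hne)))
    have hv : ∀ (J : PBond (PV d ℓ m K hd hL) 0 → ℝ) (b : PBond (PV d ℓ m K hd hL) 0), h b = 0 → h ⟨b.src.shift ν, b.dir⟩ = 0 →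
        (DV (P := PV d ℓ m K hd hL) ν cf * (mulOp h * Gl hN hk hMh1 hP4 hMha c ha₁ hpl w cf * mulOp h) * DVa (P := PV d ℓ m K hd hL) μ cf) J b = 0 := by
      intro J b h0 h1
      rw [Module.End.mul_apply, Module.End.mul_apply, DV_apply, Module.End.mul_apply, Module.End.mul_apply, mulOp_apply, mulOp_apply, h0, h1]
      ring
    intro y' J B hJ z
    rw [pairOp_mul_apply]
    have hnn : 0 ≤ ind S y' * (Cbig * tα * Real.exp (-(ρ₀ * (geomT D).dist (blkV1 hN D z) y'))) * B :=
      mul_nonneg (mul_nonneg (ind_nonneg S y') (mul_nonneg (mul_nonneg hCbig0 htα0) (Real.exp_nonneg _))) hJ.nonneg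
    by_cases hz : z = x
    · rw [if_pos hz, hv J x hx0 hx1, hv J x' hx'0 hx'1, sub_zero, abs_zero]; exact hnn
    · rw [if_neg hz, abs_zero]; exact hnn
  -- ### the active case
  -- geometry of the active pair: both blocks at levels `j₀, j₀+1`, within `d_T ≤ r₀`
  have hST : blkV1 hN D x ∈ S ∨ blkV1 hN D x' ∈ S := by
    rcases hact with h' | h' | h' | h'
    · exact Or.inl ((mem_ST D hMh1 hP4 c _).2 (blkV1_mem_QT_of_hB_ne_zero hN D hMh hR hP4 c h'))
    · exact Or.inl (blkV1_mem_ST_of_hB_shift_ne_zero hN hMh1 hP4 c hM8 hR hP5 ν h')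
    · exact Or.inr ((mem_ST D hMh1 hP4 c _).2 (blkV1_mem_QT_of_hB_ne_zero hN D hMh hR hP4 c h'))
    · exact Or.inr (blkV1_mem_ST_of_hB_shift_ne_zero hN hMh1 hP4 c hM8 hR hP5 ν h')
  have hsD : supDist x.src x'.src ≤ (ℓ + 1) ^ (j0 hMh1 hP4 c + 1) := by
    rcases hST with h' | h'
    · exact hs1.trans (Nat.pow_le_pow_right (Nat.succ_pos ℓ) (level_le_j0_succ_of_mem_ST hMh hR2 hL c h'))
    · exact hs2.trans (Nat.pow_le_pow_right (Nat.succ_pos ℓ) (level_le_j0_succ_of_mem_ST hMh hR2 hL c h'))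
  obtain ⟨⟨hjlo, hjhi⟩, ⟨hjlo', hjhi'⟩⟩ := pair_levels hN D hk (hMh1 := hMh1) (hP4 := hP4) hMha c hM8 hR2 hpl ν (x := x) (x' := x') hact hsD
  have hl1 : (blkV1 hN D x').1.1 ≤ (blkV1 hN D x).1.1 + 1 := by omega
  have hl2 : (blkV1 hN D x).1.1 ≤ (blkV1 hN D x').1.1 + 1 := by omega
  have hdT : (geomT D).dist (blkV1 hN D x) (blkV1 hN D x') ≤ r₀ := by
    rw [hr₀]; exact pair_distT_le hN D hk (hMh1 := hMh1) (hP4 := hP4) hMha c hM8 hR2 hpl ν (x := x) (x' := x') hact hsD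
  -- the scalar bounds at the output block `y(x)` (`j₀ ≤ j(y(x)) ≤ j₀ + 1`, `L^{j₀} ≤ 8S/5`)
  have hPJ : Pw ≤ L1 * J := by
    rw [hPw, hJ, ← pow_succ']; exact pow_le_pow_right₀ hL11 (by omega)
  have hPS : Pw ≤ L1 * Sf := hPJ.trans (mul_le_mul_of_nonneg_left hJS hL10.le)
  have hw1 : Pw / Sf ≤ L1 := by rw [div_le_iff₀ hSf0]; exact hPS
  have hw2 : Pw / J ≤ L1 := by rw [div_le_iff₀ hJ0]; exact hPJ
  have hw10 : 0 ≤ Pw / Sf := by positivity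
  have hw20 : 0 ≤ Pw / J := by positivity
  have hsRt : sR = t * Pw := by rw [ht, div_mul_cancel₀ _ hPw0.ne']
  have hw3 : sR / Sf ≤ L1 * tα := by
    rw [hsRt, mul_div_assoc]
    calc t * (Pw / Sf) ≤ tα * L1 := mul_le_mul httα hw1 hw10 htα0
      _ = L1 * tα := mul_comm _ _
  have hw30 : 0 ≤ sR / Sf := by positivity
  have hac : 0 < |cf| := abs_pos.2 hcf
  have hpref : pref cf (blkV1 hN D x) = Pw ^ 2 / |cf| ^ 2 := by
    show (L1 ^ (blkV1 hN D x).1.1 / cf) ^ 2 = Pw ^ 2 / |cf| ^ 2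
    rw [div_pow, sq_abs]
  have habs_s : |cf / J| = |cf| / J := by rw [abs_div, abs_of_pos hJ0]
  -- (b0) `|s(□)|·s(□)⁻¹ = 1`
  have hb0 : |sc hMh1 hP4 c cf| * (sc hMh1 hP4 c cf)⁻¹ = 1 := by
    rw [abs_of_nonneg (sc_nonneg hMh1 hP4 c cf), mul_inv_cancel₀ hscne]
  -- (b1) `σ_S ≤ (d+1)·C1F·L·t^α`
  have hb1 : σS ≤ ((d : ℝ) + 1) * C1F d ℓ * L1 * tα := by
    have e : σS = ((d : ℝ) + 1) * C1F d ℓ * (sR / Sf) := by rw [hσS]; ring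
    rw [e]
    calc ((d : ℝ) + 1) * C1F d ℓ * (sR / Sf) ≤ ((d : ℝ) + 1) * C1F d ℓ * (L1 * tα) := mul_le_mul_of_nonneg_left hw3 (by positivity)
      _ = _ := by ring
  -- (b2) `|s|·t_∇·pref(y(x)) ≤ C1F·L²`
  have hb2 : |cf / J| * tD * pref cf (blkV1 hN D x) ≤ C1F d ℓ * L1 ^ 2 := by
    have e : |cf / J| * tD * pref cf (blkV1 hN D x) = C1F d ℓ * ((Pw / J) * (Pw / Sf)) := by
      rw [habs_s, htD, hpref]; field_simp
    rw [e]
    calc C1F d ℓ * ((Pw / J) * (Pw / Sf)) ≤ C1F d ℓ * (L1 * L1) := mul_le_mul_of_nonneg_left (mul_le_mul hw2 hw1 hw10 hL10.le) hC1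
      _ = C1F d ℓ * L1 ^ 2 := by ring
  -- (b3) `|s|·σ_∇·pref(y(x)) ≤ (d+1)·C2X·L³·t^α`
  have hb3 : |cf / J| * σD * pref cf (blkV1 hN D x) ≤ ((d : ℝ) + 1) * C2X d ℓ * L1 ^ 3 * tα := by
    have e : |cf / J| * σD * pref cf (blkV1 hN D x) = ((d : ℝ) + 1) * C2X d ℓ * ((sR / Sf) * ((Pw / J) * (Pw / Sf))) := by
      rw [habs_s, hσD, hpref]; field_simp
    rw [e]
    calc ((d : ℝ) + 1) * C2X d ℓ * ((sR / Sf) * ((Pw / J) * (Pw / Sf)))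
        ≤ ((d : ℝ) + 1) * C2X d ℓ * ((L1 * tα) * (L1 * L1)) :=
          mul_le_mul_of_nonneg_left (mul_le_mul hw3 (mul_le_mul hw2 hw1 hw10 hL10.le) (by positivity) (by positivity)) (by positivity)
      _ = _ := by ring
  -- (b4) `t_∇²·pref(y(x)) ≤ C1F²·L²`
  have hb4 : tD * tD * pref cf (blkV1 hN D x) ≤ C1F d ℓ ^ 2 * L1 ^ 2 := by
    have e : tD * tD * pref cf (blkV1 hN D x) = C1F d ℓ ^ 2 * ((Pw / Sf) * (Pw / Sf)) := by
      rw [htD, hpref]; field_simp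
    rw [e]
    calc C1F d ℓ ^ 2 * ((Pw / Sf) * (Pw / Sf)) ≤ C1F d ℓ ^ 2 * (L1 * L1) := mul_le_mul_of_nonneg_left (mul_le_mul hw1 hw1 hw10 hL10.le) (by positivity)
      _ = _ := by ring
  -- (b5) `σ_∇·t_∇·pref(y(x)) ≤ (d+1)·C2X·C1F·L³·t^α`
  have hb5 : σD * tD * pref cf (blkV1 hN D x) ≤ ((d : ℝ) + 1) * C2X d ℓ * C1F d ℓ * L1 ^ 3 * tα := by
    have e : σD * tD * pref cf (blkV1 hN D x) = ((d : ℝ) + 1) * C2X d ℓ * C1F d ℓ * ((sR / Sf) * ((Pw / Sf) * (Pw / Sf))) := by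
      rw [hσD, htD, hpref]; field_simp
    rw [e]
    calc ((d : ℝ) + 1) * C2X d ℓ * C1F d ℓ * ((sR / Sf) * ((Pw / Sf) * (Pw / Sf)))
        ≤ ((d : ℝ) + 1) * C2X d ℓ * C1F d ℓ * ((L1 * tα) * (L1 * L1)) :=
          mul_le_mul_of_nonneg_left (mul_le_mul hw3 (mul_le_mul hw1 hw1 hw10 hL10.le) (by positivity) (by positivity)) (by positivity)
      _ = _ := by ring
  -- ### the pair letters of the cube for the pair
  have hQA := hPA m K hN D hk hMh1 hP4 hMha hM8 hR2 hP5 hℓ c hpl w cf ν μ r₀ hr₀0 x x' hdir hs1 hs2 hact hl1 hl2 hdT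
  obtain ⟨hQB, hQD⟩ := hPB m K hN D hk hMh1 hP4 hMha hM8 hR2 hP5 hℓ c hpl w cf ν r₀ hr₀0 x x' hdir hs1 hs2 hact hl1 hl2 hdT
  have hQC := hPC m K hN D hk hMh1 hP4 hMha hM8 hR2 hP5 hℓ c hpl w cf ν (μ, false) r₀ hr₀0 x x' hdir hs1 hs2 hact hl1 hl2 hdT
  -- the single-point letters
  have hUA := hA m K hN D hk hMh1 hP4 hMha hMh hR2 hℓ c hpl w cf ν μ
  have hUB := hEGin m K hN D hk hMh1 hP4 hMha hMh hR2 hℓ c hpl w cf (ν, true)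
  have hUC := hGEin m K hN D hk hMh1 hP4 hMha hMh hR2 hℓ c hpl w cf (μ, false)
  have hUD := hGin m K hN D hk hMh1 hP4 hMha hMh hR2 hℓ c hpl w cf
  -- ### term 1: `s²·P·(S_νh)·[E⁺G_□E⁻·(S_μh)]`
  have hT1p := hasMajorantA_mul_right_ind (g := geomT D) (blkV1 hN D) S (κ := 1 + Λh) (E := mulOp (shB (P := PV d ℓ m K hd hL) μ h)) hQA hclsμ hkillμ
  rw [mul_assoc] at hT1p
  have hT1s := hasMajorantA_mul_right_ind (g := geomT D) (blkV1 hN D) S (κ := 1 + Λh) (E := mulOp (shB (P := PV d ℓ m K hd hL) μ h)) hUA hclsμ hkillμ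
  have hT1 := hasMajorantA_pair_mulOp (g := geomT D) (blkV1 hN D) x x' (f := shB (P := PV d ℓ m K hd hL) ν h) (sf := 1)
    (nnA _ ρP hτPA0) (nnA _ ρA hCA) zero_le_one hadm hT1p hT1s hSν_le hLipS
  have hT1' := hasMajorantA_smul (g := geomT D) (blkV1 hN D) hT1 (sc hMh1 hP4 c cf)
  have hK1 := hasMajorantA_mono (g := geomT D) (blkV1 hN D) hT1' hadm
    (K' := fun a b => ind S b * ((|sc hMh1 hP4 c cf| * (1 * ((1 + Λh) * ((sc hMh1 hP4 c cf)⁻¹ * τPA)) +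
      σS * ((1 + Λh) * ((sc hMh1 hP4 c cf)⁻¹ * CA)))) * Real.exp (-(ρ₀ * (geomT D).dist a b))))
    (fun a b => by
      have key := two_terms_le (i := ind S b) (c := |sc hMh1 hP4 c cf|) (s := 1) (σ := σS)
        (A := (1 + Λh) * ((sc hMh1 hP4 c cf)⁻¹ * τPA)) (B := (1 + Λh) * ((sc hMh1 hP4 c cf)⁻¹ * CA))
        (ind_nonneg _ _) (abs_nonneg _) zero_le_one hσS0 (by positivity) (by positivity) (eρ_le rP a b) (eρ_le rA a b)
      refine le_trans (le_of_eq ?_) key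
      ring)
  -- ### term 2: `s·P·(S_νh)·[E⁺G_□·(∇_μh)]`
  have hT2p0 := hasMajorant_mul_mulOp_bdd (g := geomT D) (blkV1 hN D) (t := tD)
    (fun a b => by have := pref_nonneg cf a; positivity) htD0 hDμ_supp hDμ_le hQB
  rw [mul_assoc] at hT2p0
  have hT2p := hasMajorantA_normSupp_of_sup (g := geomT D) (blkV1 hN D) (N := fun _ J => holderV1 hN D (α + ε) J + supNormV1 J) hsupN hT2p0
  have hT2s0 := hasMajorant_mul_mulOp_bdd (g := geomT D) (blkV1 hN D) (t := tD)
    (fun a b => by have := pref_nonneg cf a; positivity) htD0 hDμ_supp hDμ_le hUB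
  have hT2s := hasMajorantA_normSupp_of_sup (g := geomT D) (blkV1 hN D) (N := fun _ J => holderV1 hN D (α + ε) J + supNormV1 J) hsupN hT2s0
  have hT2 := hasMajorantA_pair_mulOp (g := geomT D) (blkV1 hN D) x x' (f := shB (P := PV d ℓ m K hd hL) ν h) (sf := 1)
    (nnP _ ρB tD hτB0 htD0) (nnP _ ρE tD hCE htD0) zero_le_one hadm hT2p hT2s hSν_le hLipS
  have hT2' := hasMajorantA_smul (g := geomT D) (blkV1 hN D) hT2 (cf / J)
  have hK2 := hasMajorantA_mono (g := geomT D) (blkV1 hN D) hT2' hadm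
    (K' := fun a b => ind S b * ((|cf / J| * (1 * (tD * τB) + σS * (tD * CE)) * pref cf a) * Real.exp (-(ρ₀ * (geomT D).dist a b))))
    (fun a b => by
      have hp := pref_nonneg cf a
      have key := two_terms_le (i := ind S b) (c := |cf / J|) (s := 1) (σ := σS) (A := tD * (τB * pref cf a)) (B := tD * (CE * pref cf a))
        (ind_nonneg _ _) (abs_nonneg _) zero_le_one hσS0 (by positivity) (by positivity) (eρ_le rB a b) (eρ_le rE a b)
      refine le_trans (le_of_eq ?_) (key.trans (le_of_eq ?_)) <;> ring)
  -- ### term 3: `s·P·(∇_νh)·[G_□E⁻·(S_μh)]`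
  have hT3p0 := hasMajorant_mul_mulOp_bdd (g := geomT D) (blkV1 hN D) (t := 1)
    (fun a b => by have := pref_nonneg cf a; positivity) zero_le_one hSμ_supp hSμ_le hQC
  rw [mul_assoc] at hT3p0
  have hT3p := hasMajorantA_normSupp_of_sup (g := geomT D) (blkV1 hN D) (N := fun _ J => holderV1 hN D (α + ε) J + supNormV1 J) hsupN hT3p0
  have hT3s0 := hasMajorant_mul_mulOp_bdd (g := geomT D) (blkV1 hN D) (t := 1)
    (fun a b => by have := pref_nonneg cf a; positivity) zero_le_one hSμ_supp hSμ_le hUC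
  have hT3s := hasMajorantA_normSupp_of_sup (g := geomT D) (blkV1 hN D) (N := fun _ J => holderV1 hN D (α + ε) J + supNormV1 J) hsupN hT3s0
  have hT3 := hasMajorantA_pair_mulOp (g := geomT D) (blkV1 hN D) x x' (f := DV (P := PV d ℓ m K hd hL) ν cf h) (sf := tD)
    (nnP _ ρC 1 hτC0 zero_le_one) (nnP _ ρF 1 hCF zero_le_one) htD0 hadm hT3p hT3s hDν_le hLipD
  have hT3' := hasMajorantA_smul (g := geomT D) (blkV1 hN D) hT3 (cf / J)
  have hK3 := hasMajorantA_mono (g := geomT D) (blkV1 hN D) hT3' hadm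
    (K' := fun a b => ind S b * ((|cf / J| * (tD * (1 * τC) + σD * (1 * CF)) * pref cf a) * Real.exp (-(ρ₀ * (geomT D).dist a b))))
    (fun a b => by
      have hp := pref_nonneg cf a
      have key := two_terms_le (i := ind S b) (c := |cf / J|) (s := tD) (σ := σD) (A := 1 * (τC * pref cf a)) (B := 1 * (CF * pref cf a))
        (ind_nonneg _ _) (abs_nonneg _) htD0 hσD0 (by positivity) (by positivity) (eρ_le rC a b) (eρ_le rF a b)
      refine le_trans (le_of_eq ?_) (key.trans (le_of_eq ?_)) <;> ring)
  -- ### term 4: `P·(∇_νh)·[G_□·(∇_μh)]`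
  have hT4p0 := hasMajorant_mul_mulOp_bdd (g := geomT D) (blkV1 hN D) (t := tD)
    (fun a b => by have := pref_nonneg cf a; positivity) htD0 hDμ_supp hDμ_le hQD
  rw [mul_assoc] at hT4p0
  have hT4p := hasMajorantA_normSupp_of_sup (g := geomT D) (blkV1 hN D) (N := fun _ J => holderV1 hN D (α + ε) J + supNormV1 J) hsupN hT4p0
  have hT4s0 := hasMajorant_mul_mulOp_bdd (g := geomT D) (blkV1 hN D) (t := tD)
    (fun a b => by have := pref_nonneg cf a; positivity) htD0 hDμ_supp hDμ_le hUD
  have hT4s := hasMajorantA_normSupp_of_sup (g := geomT D) (blkV1 hN D) (N := fun _ J => holderV1 hN D (α + ε) J + supNormV1 J) hsupN hT4s0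
  have hT4 := hasMajorantA_pair_mulOp (g := geomT D) (blkV1 hN D) x x' (f := DV (P := PV d ℓ m K hd hL) ν cf h) (sf := tD)
    (nnP _ ρB tD hτB0 htD0) (nnP _ ρG tD hCG htD0) htD0 hadm hT4p hT4s hDν_le hLipD
  have hK4 := hasMajorantA_mono (g := geomT D) (blkV1 hN D) hT4 hadm
    (K' := fun a b => ind S b * (((tD * (tD * τB) + σD * (tD * CG)) * pref cf a) * Real.exp (-(ρ₀ * (geomT D).dist a b))))
    (fun a b => by
      have hp := pref_nonneg cf a
      have key := two_terms_le (i := ind S b) (c := 1) (s := tD) (σ := σD) (A := tD * (τB * pref cf a)) (B := tD * (CG * pref cf a))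
        (ind_nonneg _ _) zero_le_one htD0 hσD0 (by positivity) (by positivity) (eρ_le rB a b) (eρ_le rG a b)
      refine le_trans (le_of_eq ?_) (key.trans (le_of_eq ?_)) <;> ring)
  -- ### the sum, the operator identity, the output localisation at `y(x)`
  have hsum := hasMajorantA_add _ (hasMajorantA_add _ (hasMajorantA_add _ hK1 hK2) hK3) hK4
  have e : pairOp x x' * (DV (P := PV d ℓ m K hd hL) ν cf * (mulOp h * Gl hN hk hMh1 hP4 hMha c ha₁ hpl w cf * mulOp h) *
        DVa (P := PV d ℓ m K hd hL) μ cf) =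
      sc hMh1 hP4 c cf • (pairOp x x' * (mulOp (shB (P := PV d ℓ m K hd hL) ν h) *
        (EC hN hk hMh1 hP4 hMha c ha₁ hpl w cf (ν, true) * Gl hN hk hMh1 hP4 hMha c ha₁ hpl w cf * EC hN hk hMh1 hP4 hMha c ha₁ hpl w cf (μ, false) *
          mulOp (shB (P := PV d ℓ m K hd hL) μ h)))) +
      (cf / J) • (pairOp x x' * (mulOp (shB (P := PV d ℓ m K hd hL) ν h) *
        (EC hN hk hMh1 hP4 hMha c ha₁ hpl w cf (ν, true) * Gl hN hk hMh1 hP4 hMha c ha₁ hpl w cf * mulOp (DV (P := PV d ℓ m K hd hL) μ cf h)))) +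
      (cf / J) • (pairOp x x' * (mulOp (DV (P := PV d ℓ m K hd hL) ν cf h) *
        (Gl hN hk hMh1 hP4 hMha c ha₁ hpl w cf * EC hN hk hMh1 hP4 hMha c ha₁ hpl w cf (μ, false) * mulOp (shB (P := PV d ℓ m K hd hL) μ h)))) +
      pairOp x x' * (mulOp (DV (P := PV d ℓ m K hd hL) ν cf h) * (Gl hN hk hMh1 hP4 hMha c ha₁ hpl w cf * mulOp (DV (P := PV d ℓ m K hd hL) μ cf h))) := by
    rw [grad2_sandwich_eq hN hk hMh1 hP4 hMha c ha₁ ha₀ hM8 hR2 hpl w hcf ν μ]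
    simp only [mul_add, mul_smul_comm, mul_assoc]
    rfl
  rw [← e] at hsum
  have hloc := hasMajorantA_localise_out (g := geomT D) (blkV1 hN D) hsum (outLoc_pairOp_mul (g := geomT D) (blkV1 hN D) x x' _)
  refine hasMajorantA_mono (g := geomT D) (blkV1 hN D) hloc hadm fun a b => ?_
  -- ### the kernels at the output block `y(x)`
  have hi := ind_nonneg S b
  have he0 : 0 ≤ Real.exp (-(ρ₀ * (geomT D).dist a b)) := Real.exp_nonneg _
  have hTgt : 0 ≤ ind S b * (Cbig * tα * Real.exp (-(ρ₀ * (geomT D).dist a b))) :=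
    mul_nonneg hi (mul_nonneg (mul_nonneg hCbig0 htα0) he0)
  by_cases ha : a = blkV1 hN D x
  swap
  · have key : ∀ (S' : Set (geomT D).Site) (Y : ℝ), a ∉ S' → ind S' a * Y ≤ ind S b * (Cbig * tα * Real.exp (-(ρ₀ * (geomT D).dist a b))) :=
      fun S' Y hm => by rw [ind_of_not_mem hm, zero_mul]; exact hTgt
    exact key _ _ (fun hm => ha (Set.mem_singleton_iff.1 hm))
  subst ha
  have key1 : ∀ (S' : Set (geomT D).Site) (Y Z : ℝ), blkV1 hN D x ∈ S' → Y ≤ Z → ind S' (blkV1 hN D x) * Y ≤ Z :=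
    fun S' Y Z hm hYZ => by rw [ind_of_mem hm, one_mul]; exact hYZ
  refine key1 _ _ _ (Set.mem_singleton _) ?_
  -- the four groups at `y(x)`
  have hp0 := pref_nonneg cf (blkV1 hN D x)
  have i1 : |sc hMh1 hP4 c cf| * (1 * ((1 + Λh) * ((sc hMh1 hP4 c cf)⁻¹ * τPA)) + σS * ((1 + Λh) * ((sc hMh1 hP4 c cf)⁻¹ * CA))) ≤
      (1 + Λh) * (CPA * EP * L1 ^ 2 + ((d : ℝ) + 1) * C1F d ℓ * L1 * CA) * tα := by
    have e1 : |sc hMh1 hP4 c cf| * (1 * ((1 + Λh) * ((sc hMh1 hP4 c cf)⁻¹ * τPA)) + σS * ((1 + Λh) * ((sc hMh1 hP4 c cf)⁻¹ * CA))) =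
        (|sc hMh1 hP4 c cf| * (sc hMh1 hP4 c cf)⁻¹) * ((1 + Λh) * (τPA + σS * CA)) := by ring
    rw [e1, hb0, one_mul]
    have h2 : σS * CA ≤ ((d : ℝ) + 1) * C1F d ℓ * L1 * tα * CA := mul_le_mul_of_nonneg_right hb1 hCA
    calc (1 + Λh) * (τPA + σS * CA) ≤ (1 + Λh) * (CPA * EP * (L1 ^ 2 * tα) + ((d : ℝ) + 1) * C1F d ℓ * L1 * tα * CA) :=
          mul_le_mul_of_nonneg_left (add_le_add le_rfl h2) (by positivity)
      _ = _ := by ring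
  have i2 : |cf / J| * (1 * (tD * τB) + σS * (tD * CE)) * pref cf (blkV1 hN D x) ≤
      C1F d ℓ * L1 ^ 2 * (CPB * EB * L1 ^ 2 + ((d : ℝ) + 1) * C1F d ℓ * L1 * CE) * tα := by
    have e2 : |cf / J| * (1 * (tD * τB) + σS * (tD * CE)) * pref cf (blkV1 hN D x) =
        (|cf / J| * tD * pref cf (blkV1 hN D x)) * (τB + σS * CE) := by ring
    rw [e2]
    have h2 : σS * CE ≤ ((d : ℝ) + 1) * C1F d ℓ * L1 * tα * CE := mul_le_mul_of_nonneg_right hb1 hCE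
    calc (|cf / J| * tD * pref cf (blkV1 hN D x)) * (τB + σS * CE)
        ≤ (C1F d ℓ * L1 ^ 2) * (CPB * EB * (L1 ^ 2 * tα) + ((d : ℝ) + 1) * C1F d ℓ * L1 * tα * CE) :=
          mul_le_mul hb2 (add_le_add le_rfl h2) (by positivity) (by positivity)
      _ = _ := by ring
  have i3 : |cf / J| * (tD * (1 * τC) + σD * (1 * CF)) * pref cf (blkV1 hN D x) ≤
      (C1F d ℓ * L1 ^ 2 * (CPC * EC' * L1 ^ 2) + ((d : ℝ) + 1) * C2X d ℓ * L1 ^ 3 * CF) * tα := by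
    have e3 : |cf / J| * (tD * (1 * τC) + σD * (1 * CF)) * pref cf (blkV1 hN D x) =
        (|cf / J| * tD * pref cf (blkV1 hN D x)) * τC + (|cf / J| * σD * pref cf (blkV1 hN D x)) * CF := by ring
    rw [e3]
    calc (|cf / J| * tD * pref cf (blkV1 hN D x)) * τC + (|cf / J| * σD * pref cf (blkV1 hN D x)) * CF
        ≤ (C1F d ℓ * L1 ^ 2) * τC + (((d : ℝ) + 1) * C2X d ℓ * L1 ^ 3 * tα) * CF :=
          add_le_add (mul_le_mul_of_nonneg_right hb2 hτC0) (mul_le_mul_of_nonneg_right hb3 hCF)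
      _ = _ := by ring
  have i4 : (tD * (tD * τB) + σD * (tD * CG)) * pref cf (blkV1 hN D x) ≤
      (C1F d ℓ ^ 2 * L1 ^ 2 * (CPB * EB * L1 ^ 2) + ((d : ℝ) + 1) * C2X d ℓ * C1F d ℓ * L1 ^ 3 * CG) * tα := by
    have e4 : (tD * (tD * τB) + σD * (tD * CG)) * pref cf (blkV1 hN D x) =
        (tD * tD * pref cf (blkV1 hN D x)) * τB + (σD * tD * pref cf (blkV1 hN D x)) * CG := by ring
    rw [e4]
    calc (tD * tD * pref cf (blkV1 hN D x)) * τB + (σD * tD * pref cf (blkV1 hN D x)) * CG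
        ≤ (C1F d ℓ ^ 2 * L1 ^ 2) * τB + (((d : ℝ) + 1) * C2X d ℓ * C1F d ℓ * L1 ^ 3 * tα) * CG :=
          add_le_add (mul_le_mul_of_nonneg_right hb4 hτB0) (mul_le_mul_of_nonneg_right hb5 hCG)
      _ = _ := by ring
  have hsum4 := add_le_add (add_le_add (add_le_add i1 i2) i3) i4
  calc ind S b * ((|sc hMh1 hP4 c cf| * (1 * ((1 + Λh) * ((sc hMh1 hP4 c cf)⁻¹ * τPA)) + σS * ((1 + Λh) * ((sc hMh1 hP4 c cf)⁻¹ * CA)))) *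
          Real.exp (-(ρ₀ * (geomT D).dist (blkV1 hN D x) b))) +
        ind S b * ((|cf / J| * (1 * (tD * τB) + σS * (tD * CE)) * pref cf (blkV1 hN D x)) * Real.exp (-(ρ₀ * (geomT D).dist (blkV1 hN D x) b))) +
        ind S b * ((|cf / J| * (tD * (1 * τC) + σD * (1 * CF)) * pref cf (blkV1 hN D x)) * Real.exp (-(ρ₀ * (geomT D).dist (blkV1 hN D x) b))) +
        ind S b * (((tD * (tD * τB) + σD * (tD * CG)) * pref cf (blkV1 hN D x)) * Real.exp (-(ρ₀ * (geomT D).dist (blkV1 hN D x) b)))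
      = ind S b * ((|sc hMh1 hP4 c cf| * (1 * ((1 + Λh) * ((sc hMh1 hP4 c cf)⁻¹ * τPA)) + σS * ((1 + Λh) * ((sc hMh1 hP4 c cf)⁻¹ * CA))) +
          |cf / J| * (1 * (tD * τB) + σS * (tD * CE)) * pref cf (blkV1 hN D x) +
          |cf / J| * (tD * (1 * τC) + σD * (1 * CF)) * pref cf (blkV1 hN D x) +
          (tD * (tD * τB) + σD * (tD * CG)) * pref cf (blkV1 hN D x)) * Real.exp (-(ρ₀ * (geomT D).dist (blkV1 hN D x) b))) := by ring
    _ ≤ ind S b * (Cbig * tα * Real.exp (-(ρ₀ * (geomT D).dist (blkV1 hN D x) b))) := by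
        refine mul_le_mul_of_nonneg_left (mul_le_mul_of_nonneg_right ?_ (Real.exp_nonneg _)) hi
        refine hsum4.trans (le_of_eq ?_)
        rw [hCbig]; ring

end Leg

end Literature.MathematicalPhysics.QuantumFieldTheory.Balaban1983to89.B6HolderGrad2NormSuppLegKLevelV1

end
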